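import Summits.CriticalPhenomena.PercolationContinuityZ3.Theorems.PercNearOneGluingAdditiveGluingClusterPeelMuE
import HarnessLib

/-! # Crux `PercNearOneGluing.AdditiveGluing` (stmt-CriticalPhenomena-4576) — GRADED forms of the (MU-opt)/(MU-E) peeling reductions:
# the kernel for `3 ≤ |A| ≤ K`  ⇒  `AdditiveGluing` for `|A| ≤ K`

Support file (`--supports stmt-CriticalPhenomena-4576`, cell `prim-png-dp-al5` gen 5).  No definitions, no named facts, no sorries.  Companion of
`…ClusterPeelMuE.lean` (`additiveGluing_of_muE/_of_muOpt`: the kernel for ALL `|A| ≥ 3` gives the crux).  Here the size bound is threaded through the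
same induction (`agFail_card_of_muOpt`), so that the FIRST open case pays by itself: `additiveGluing_card_of_muE 3` says that ttrl2's census object
(MU-E) for `|A| = 3` ALONE — `∃ d ∈ {a₁,a₂,a₃}: m1(d) ≥ 0`, whose residual instances have `≤ 2` relays (AdditiveGluing proved there) — gives
`AdditiveGluing` for every relay set of size `≤ 3` (the three-relay case singled out as open by the lead, LeadMath-g4 §2).
Kernel shapes are those of `…ClusterPeelMuE.lean` verbatim plus the binder `A.card ≤ K`.
[cite: KozmaNitzan2024, §3.2 p. 12 (conditioning on C(0) = W, the graphs G ∖ W); Thm. 1 pp. 7–8]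
-/

namespace Summit.CriticalPhenomena.PercolationContinuityZ3.Theorems

open MeasureTheory Set
open Literature.Probability.LatticeModels (prodBernoulli)
open Literature.Probability.Percolation
open scoped BigOperators

noncomputable section
open Classical

namespace ClusterPeelMuECard

open ClusterPeel ClusterPeelMuE

/-- **Graded form: (MU-opt) for `3 ≤ |A| ≤ K` ⇒ the failure form `μ(o ↔ A, o ↮ b) ≤ t` for `|A| ≤ K`** (`A ∌ b`, `0 ≤ t`, `τ ≥ 1 − t` on `A`).
Same proof as `ClusterPeelMuE.agFail_of_muOpt` with the size bound threaded; strong induction on `|A|`: `|A| ≤ 2` is `ClusterPeel.agFail_card_le_two`; `o ∈ A`, `o = b` immediate; otherwise peel the relay `d` of the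
kernel with `β W = B_W(S_W)`: the residual failure event of `G − W` is covered by the failure event of the sub-collection `S_W` (induction
hypothesis on `restrW Wᶜ w`, `|S_W| < |A|`) and the remainder `{o ↔ surv∖S_W, o ↮ S_W}` (union bound). [cite: KozmaNitzan2024, §3.2 p. 12] -/
theorem agFail_card_of_muOpt (K : ℕ)
    (hMU : ∀ (n : ℕ) (w : Sym2 (Fin n) → unitInterval) (A : Finset (Fin n)) (o b : Fin n) (θ : ℝ),
      o ∉ A → b ∉ A → o ≠ b → 3 ≤ A.card → A.card ≤ K → (∀ a ∈ A, θ ≤ (prodBernoulli w).real (openConn a b)) →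
      ∃ d ∈ A, ∃ S : Finset (Fin n) → Finset (Fin n), (∀ W, S W ⊆ A \ W) ∧
        (prodBernoulli w).real (openConn d b ∩ (openConn d o)ᶜ ∩ (⋃ a ∈ A.erase d, openConn o a)) + θ ≤
        (prodBernoulli w).real (openConn d b) +
          ∑ W ∈ Finset.univ.filter (fun W : Finset (Fin n) => o ∉ W ∧ b ∉ W),
            (prodBernoulli w).real (clusterIs d W) *
              (1 - ((if h : (S W).Nonempty then 1 - (S W).inf' h (fun a => (prodBernoulli w).real (openConnIn ((↑W : Set (Fin n))ᶜ) a b))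
                     else 0)
                + (prodBernoulli w).real ((⋃ a ∈ (A \ W) \ S W, openConnIn ((↑W : Set (Fin n))ᶜ) o a) ∩
                    (⋃ a ∈ S W, openConnIn ((↑W : Set (Fin n))ᶜ) o a)ᶜ))))
    (n : ℕ) :
    ∀ (K' : ℕ), K' ≤ K → ∀ (w : Sym2 (Fin n) → unitInterval) (A : Finset (Fin n)) (o b : Fin n) (t : ℝ),
      A.card ≤ K' → b ∉ A → 0 ≤ t → (∀ a ∈ A, 1 - t ≤ (prodBernoulli w).real (openConn a b)) →
      (prodBernoulli w).real ((⋃ a ∈ A, openConn o a) ∩ (openConn o b)ᶜ) ≤ t := by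
  intro K'
  induction K' with
  | zero =>
    intro _ w A o b t hA hb ht hτ
    exact agFail_card_le_two w A o b t (by omega) ht hτ
  | succ K' ih' =>
    intro hK w A o b t hA hb ht hτ
    have ih := ih' (by omega)
    have hmeas : ∀ E : Set (BondConfig (Fin n)), MeasurableSet E := fun E => MeasurableSet.of_discrete
    by_cases hA2 : A.card ≤ 2
    · exact agFail_card_le_two w A o b t hA2 ht hτ
    by_cases ho : o ∈ A
    · calc (prodBernoulli w).real ((⋃ a ∈ A, openConn o a) ∩ (openConn o b)ᶜ)
          ≤ (prodBernoulli w).real ((openConn o b)ᶜ : Set (BondConfig (Fin n))) := measureReal_mono inter_subset_right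
        _ = 1 - (prodBernoulli w).real (openConn o b) := probReal_compl_eq_one_sub (hmeas _)
        _ ≤ t := by linarith [hτ o ho]
    by_cases hob : o = b
    · subst hob
      have : ((⋃ a ∈ A, openConn o a) ∩ (openConn o o)ᶜ : Set (BondConfig (Fin n))) = ∅ := by
        ext ω
        simp only [mem_inter_iff, mem_compl_iff, mem_empty_iff_false, iff_false, not_and, not_not]
        intro _
        exact SimpleGraph.Reachable.refl o
      rw [this]; simp [ht]
    have hA3 : 3 ≤ A.card := by omega
    obtain ⟨d, hdA, S, hS, hker⟩ := hMU n w A o b (1 - t) ho hb hob hA3 (by omega) hτ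
    -- abbreviations: residual reliability of the chosen sub-collection and the remainder term
    set Wc : Finset (Fin n) → Set (Fin n) := fun W => ((↑W : Set (Fin n))ᶜ) with hWc
    set m : Finset (Fin n) → ℝ := fun W =>
      if h : (S W).Nonempty then 1 - (S W).inf' h (fun a => (prodBernoulli w).real (openConnIn (Wc W) a b)) else 0 with hm
    set r : Finset (Fin n) → ℝ := fun W =>
      (prodBernoulli w).real ((⋃ a ∈ (A \ W) \ S W, openConnIn (Wc W) o a) ∩ (⋃ a ∈ S W, openConnIn (Wc W) o a)ᶜ) with hr
    have hβ : ∀ W : Finset (Fin n), o ∉ W → b ∉ W → d ∈ W →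
        (prodBernoulli w).real ((⋃ a ∈ A \ W, openConnIn (Wc W) o a) ∩ (openConnIn (Wc W) o b)ᶜ) ≤ m W + r W := by
      intro W hoW hbW hdW
      -- cover: residual failure ⊆ failure of the sub-collection ∪ remainder
      have hcover : ((⋃ a ∈ A \ W, openConnIn (Wc W) o a) ∩ (openConnIn (Wc W) o b)ᶜ : Set (BondConfig (Fin n))) ⊆
          ((⋃ a ∈ S W, openConnIn (Wc W) o a) ∩ (openConnIn (Wc W) o b)ᶜ) ∪
            ((⋃ a ∈ (A \ W) \ S W, openConnIn (Wc W) o a) ∩ (⋃ a ∈ S W, openConnIn (Wc W) o a)ᶜ) := by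
        rintro ω ⟨hoA, hob'⟩
        by_cases hS' : ω ∈ (⋃ a ∈ S W, openConnIn (Wc W) o a : Set (BondConfig (Fin n)))
        · exact Or.inl ⟨hS', hob'⟩
        · refine Or.inr ⟨?_, hS'⟩
          simp only [mem_iUnion, exists_prop] at hoA hS' ⊢
          obtain ⟨a, haA, hoa⟩ := hoA
          refine ⟨a, Finset.mem_sdiff.2 ⟨haA, fun haS => hS' ⟨a, haS, hoa⟩⟩, hoa⟩
      -- the sub-collection: induction hypothesis on G − W
      have hsub : (prodBernoulli w).real ((⋃ a ∈ S W, openConnIn (Wc W) o a) ∩ (openConnIn (Wc W) o b)ᶜ) ≤ m W := by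
        by_cases hne : (S W).Nonempty
        · have hmW : m W = 1 - (S W).inf' hne (fun a => (prodBernoulli w).real (openConnIn (Wc W) a b)) := by
            simp only [hm, dif_pos hne]
          have hcard : (S W).card ≤ K' := by
            have h1 : (S W).card ≤ (A \ W).card := Finset.card_le_card (hS W)
            have h2 : (A \ W).card < A.card :=
              Finset.card_lt_card ⟨Finset.sdiff_subset, fun h => (Finset.mem_sdiff.1 (h hdA)).2 hdW⟩
            omega
          have hbS : b ∉ S W := fun h => hb (Finset.mem_sdiff.1 (hS W h)).1
          have ht' : 0 ≤ m W := by
            rw [hmW]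
            obtain ⟨a, ha⟩ := hne
            have := Finset.inf'_le (fun a => (prodBernoulli w).real (openConnIn (Wc W) a b)) ha
            linarith [measureReal_le_one (μ := prodBernoulli w) (s := openConnIn (Wc W) a b)]
          have hτ' : ∀ a ∈ S W, 1 - m W ≤ (prodBernoulli (restrW (Wc W) w)).real (openConn a b) := by
            intro a ha
            rw [hmW, sub_sub_cancel, hWc, restr_real_openConn w W (Finset.mem_sdiff.1 (hS W ha)).2 b]
            exact Finset.inf'_le _ ha
          have := ih (restrW (Wc W) w) (S W) o b (m W) hcard hbS ht' hτ'
          rwa [hWc, restr_real_fail w W (S W) hoW b] at this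
        · have hmW : m W = 0 := by simp only [hm, dif_neg hne]
          rw [Finset.not_nonempty_iff_eq_empty.1 hne, hmW]
          simp
      calc (prodBernoulli w).real ((⋃ a ∈ A \ W, openConnIn (Wc W) o a) ∩ (openConnIn (Wc W) o b)ᶜ)
          ≤ (prodBernoulli w).real (((⋃ a ∈ S W, openConnIn (Wc W) o a) ∩ (openConnIn (Wc W) o b)ᶜ) ∪
              ((⋃ a ∈ (A \ W) \ S W, openConnIn (Wc W) o a) ∩ (⋃ a ∈ S W, openConnIn (Wc W) o a)ᶜ)) :=
            measureReal_mono hcover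
        _ ≤ (prodBernoulli w).real ((⋃ a ∈ S W, openConnIn (Wc W) o a) ∩ (openConnIn (Wc W) o b)ᶜ) + r W :=
            measureReal_union_le _ _
        _ ≤ m W + r W := by linarith
    have hpeel := peel_bound w A o b d (fun W => m W + r W) hβ
    linarith

/-- **Graded crux from (MU-opt): the kernel for `3 ≤ |A| ≤ K` gives `AdditiveGluing` for every relay set with `|A| ≤ K`.**
(`{o ↔ A} ⊆ {o ↔ b} ∪ {o ↔ A∖b, o ↮ b}` and `agFail_card_of_muOpt` on `A ∖ b`, `|A ∖ b| ≤ K`.) [cite: KozmaNitzan2024, §3.2 p. 12] -/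
theorem additiveGluing_card_of_muOpt (K : ℕ)
    (hMU : ∀ (n : ℕ) (w : Sym2 (Fin n) → unitInterval) (A : Finset (Fin n)) (o b : Fin n) (θ : ℝ),
      o ∉ A → b ∉ A → o ≠ b → 3 ≤ A.card → A.card ≤ K → (∀ a ∈ A, θ ≤ (prodBernoulli w).real (openConn a b)) →
      ∃ d ∈ A, ∃ S : Finset (Fin n) → Finset (Fin n), (∀ W, S W ⊆ A \ W) ∧
        (prodBernoulli w).real (openConn d b ∩ (openConn d o)ᶜ ∩ (⋃ a ∈ A.erase d, openConn o a)) + θ ≤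
        (prodBernoulli w).real (openConn d b) +
          ∑ W ∈ Finset.univ.filter (fun W : Finset (Fin n) => o ∉ W ∧ b ∉ W),
            (prodBernoulli w).real (clusterIs d W) *
              (1 - ((if h : (S W).Nonempty then 1 - (S W).inf' h (fun a => (prodBernoulli w).real (openConnIn ((↑W : Set (Fin n))ᶜ) a b))
                     else 0)
                + (prodBernoulli w).real ((⋃ a ∈ (A \ W) \ S W, openConnIn ((↑W : Set (Fin n))ᶜ) o a) ∩
                    (⋃ a ∈ S W, openConnIn ((↑W : Set (Fin n))ᶜ) o a)ᶜ)))) :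
    ∀ (n : ℕ) (w : Sym2 (Fin n) → unitInterval) (A : Finset (Fin n)) (o b : Fin n) (t : ℝ), A.card ≤ K → 0 ≤ t →
      (∀ a ∈ A, 1 - t ≤ (prodBernoulli w).real (openConn a b)) →
      (prodBernoulli w).real (⋃ a ∈ A, openConn o a) - t ≤ (prodBernoulli w).real (openConn o b) := by
  intro n w A o b t hA ht hτ
  set A' : Finset (Fin n) := A.erase b with hA'
  have hbA' : b ∉ A' := Finset.notMem_erase b A
  have hτ' : ∀ a ∈ A', 1 - t ≤ (prodBernoulli w).real (openConn a b) := fun a ha => hτ a (Finset.mem_of_mem_erase ha)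
  have hcard : A'.card ≤ K := (Finset.card_le_card (Finset.erase_subset b A)).trans hA
  have hfail := agFail_card_of_muOpt K hMU n A'.card hcard w A' o b t le_rfl hbA' ht hτ'
  have hsub : ((⋃ a ∈ A, openConn o a) : Set (BondConfig (Fin n))) ⊆
      openConn o b ∪ ((⋃ a ∈ A', openConn o a) ∩ (openConn o b)ᶜ) := by
    intro ω hω
    by_cases hob : ω ∈ (openConn o b : Set (BondConfig (Fin n)))
    · exact Or.inl hob
    · refine Or.inr ⟨?_, hob⟩
      simp only [mem_iUnion, exists_prop] at hω ⊢
      obtain ⟨a, haA, hoa⟩ := hω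
      refine ⟨a, Finset.mem_erase.2 ⟨?_, haA⟩, hoa⟩
      rintro rfl
      exact hob hoa
  calc (prodBernoulli w).real (⋃ a ∈ A, openConn o a) - t
      ≤ (prodBernoulli w).real (openConn o b ∪ ((⋃ a ∈ A', openConn o a) ∩ (openConn o b)ᶜ)) - t := by
        linarith [measureReal_mono (μ := prodBernoulli w) hsub]
    _ ≤ (prodBernoulli w).real (openConn o b) + (prodBernoulli w).real ((⋃ a ∈ A', openConn o a) ∩ (openConn o b)ᶜ) - t := by
        linarith [measureReal_union_le (μ := prodBernoulli w) (openConn o b : Set (BondConfig (Fin n)))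
          ((⋃ a ∈ A', openConn o a) ∩ (openConn o b)ᶜ)]
    _ ≤ (prodBernoulli w).real (openConn o b) := by linarith

/-- **Graded crux from (MU-E): ttrl2's `∃ d, m1(d) ≥ 0` for `3 ≤ |A| ≤ K` gives `AdditiveGluing` for every relay set with `|A| ≤ K`.**  With `K = 3`:
(MU-E)(3) alone (residual sets of ≤ 2 relays) proves the three-relay case of the crux. [cite: KozmaNitzan2024, §3.2 p. 12; Thm. 1 pp. 7–8] -/
theorem additiveGluing_card_of_muE (K : ℕ)
    (hMUE : ∀ (n : ℕ) (w : Sym2 (Fin n) → unitInterval) (A : Finset (Fin n)) (o b : Fin n) (θ : ℝ),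
      o ∉ A → b ∉ A → o ≠ b → 3 ≤ A.card → A.card ≤ K → (∀ a ∈ A, θ ≤ (prodBernoulli w).real (openConn a b)) →
      ∃ d ∈ A, (prodBernoulli w).real (openConn d b ∩ (openConn d o)ᶜ ∩ (⋃ a ∈ A.erase d, openConn o a)) + θ ≤
        (prodBernoulli w).real (openConn d b) +
          ∑ W ∈ Finset.univ.filter (fun W : Finset (Fin n) => o ∉ W ∧ b ∉ W),
            (prodBernoulli w).real (clusterIs d W) *
              (if h : (A \ W).Nonempty then (A \ W).inf' h (fun a => (prodBernoulli w).real (openConnIn ((↑W : Set (Fin n))ᶜ) a b))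
               else 1)) :
    ∀ (n : ℕ) (w : Sym2 (Fin n) → unitInterval) (A : Finset (Fin n)) (o b : Fin n) (t : ℝ), A.card ≤ K → 0 ≤ t →
      (∀ a ∈ A, 1 - t ≤ (prodBernoulli w).real (openConn a b)) →
      (prodBernoulli w).real (⋃ a ∈ A, openConn o a) - t ≤ (prodBernoulli w).real (openConn o b) := by
  refine additiveGluing_card_of_muOpt K fun n w A o b θ ho hb hob hA hAK hθ => ?_
  obtain ⟨d, hdA, hker⟩ := hMUE n w A o b θ ho hb hob hA hAK hθ
  refine ⟨d, hdA, fun W => A \ W, fun W => subset_rfl, ?_⟩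
  have hterm : ∀ W : Finset (Fin n),
      (1 - ((if h : (A \ W).Nonempty then 1 - (A \ W).inf' h (fun a => (prodBernoulli w).real (openConnIn ((↑W : Set (Fin n))ᶜ) a b))
              else 0)
        + (prodBernoulli w).real ((⋃ a ∈ (A \ W) \ (A \ W), openConnIn ((↑W : Set (Fin n))ᶜ) o a) ∩
            (⋃ a ∈ A \ W, openConnIn ((↑W : Set (Fin n))ᶜ) o a)ᶜ))) =
      (if h : (A \ W).Nonempty then (A \ W).inf' h (fun a => (prodBernoulli w).real (openConnIn ((↑W : Set (Fin n))ᶜ) a b)) else 1) := by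
    intro W
    rw [Finset.sdiff_self]
    simp only [Finset.notMem_empty, iUnion_of_empty, iUnion_empty, empty_inter, measureReal_empty, add_zero]
    split_ifs <;> ring
  simp only [hterm]
  exact hker

end ClusterPeelMuECard

end

end Summit.CriticalPhenomena.PercolationContinuityZ3.Theorems
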